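import Summits.QuantumAdvantage.AdviceFreeQNC0.PLDAMSAllDensities
import HarnessLib

/-!
# Cell qa-qnc0 — support inequalities transfer verbatim to vector-valued low-degree maps

For `σ = (σ_1, …, σ_m) : {0,1}ⁿ → 𝔽₂^m` with every coordinate of degree `≤ d`, the zero-set complement
`Z = {u : σ u ≠ 0} = ⋃_j supp σ_j` satisfies, POINTWISE,
`2 · #{T ⊆ [m] : (Σ_{j∈T} σ_j)(u) ≠ 0} = 2^m · 1_Z(u)` (for `u ∈ Z` exactly half of the sub-sums are
non-zero: the involution `T ↦ T ∆ {j₀}` with `σ_{j₀}(u) = 1`), and every sub-sum has degree `≤ d`.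
Hence every inequality that is LINEAR in the indicator of a low-degree support — PLDAMS
(`pldams_allDensities`), the relative Hegedűs lemma, crux β — holds for `Z` with the same constants
(`support_ineq_transfer`). Corollary `pldams_vector`: the set of rows of a column-degree-`≤ d` map that
miss an affine family `𝟙 + C` (`C` linear; = `{syndrome ≠ 0}`) is `κ`-balanced over the residue classes
mod 3 — the threshold-1 case of the weighted statement `LDMAPolylog` of line `product`
(LIT-MEMO-12 §3; the weighted statement itself does NOT decouple, ibid. §2).
-/

namespace Summit.QuantumAdvantage.AdviceFreeQNC0

open Finset Literature.Computability.MetaComplexity Literature.Computability.MetaComplexity.Smolensky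
open Literature.Computability.MetaComplexity.Hegedus

variable {n m : ℕ}

/-- The sub-sum of the coordinates in `T`. -/
private theorem subsum_mem_lowDeg {d : ℕ} (σ : Fin m → CubeFn (ZMod 2) n)
    (hσ : ∀ j, σ j ∈ lowDeg (ZMod 2) n d) (T : Finset (Fin m)) :
    (∑ j ∈ T, σ j) ∈ lowDeg (ZMod 2) n d :=
  Submodule.sum_mem _ fun j _ => hσ j

/-- Toggling one index with `σ_{j₀}(u) = 1` flips the value of the sub-sum at `u`. -/
private theorem subsum_symmDiff_apply (σ : Fin m → CubeFn (ZMod 2) n) (u : Fin n → Bool)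
    (T : Finset (Fin m)) (j₀ : Fin m) (hj : σ j₀ u = 1) :
    (∑ j ∈ symmDiff T {j₀}, σ j) u = (∑ j ∈ T, σ j) u + 1 := by
  classical
  rw [Finset.sum_apply, Finset.sum_apply]
  by_cases h : j₀ ∈ T
  · have hsd : symmDiff T {j₀} = T.erase j₀ := by
      ext j
      simp only [Finset.mem_symmDiff, Finset.mem_singleton, Finset.mem_erase]
      constructor
      · rintro (⟨hjT, hne⟩ | ⟨rfl, hnot⟩)
        · exact ⟨hne, hjT⟩
        · exact absurd h hnot
      · rintro ⟨hne, hjT⟩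
        exact Or.inl ⟨hjT, hne⟩
    rw [hsd, ← Finset.add_sum_erase T (fun j => σ j u) h, hj]
    -- `x = 1 + x + 1` in `ZMod 2`
    have h2 : (1 : ZMod 2) + 1 = 0 := by decide
    calc ∑ x ∈ T.erase j₀, σ x u = (1 + 1) + ∑ x ∈ T.erase j₀, σ x u := by rw [h2, zero_add]
      _ = 1 + ∑ x ∈ T.erase j₀, σ x u + 1 := by ring
  · have hsd : symmDiff T {j₀} = insert j₀ T := by
      ext j
      simp only [Finset.mem_symmDiff, Finset.mem_singleton, Finset.mem_insert]
      constructor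
      · rintro (⟨hjT, _⟩ | ⟨rfl, _⟩)
        · exact Or.inr hjT
        · exact Or.inl rfl
      · rintro (rfl | hjT)
        · exact Or.inr ⟨rfl, h⟩
        · exact Or.inl ⟨hjT, fun he => h (he ▸ hjT)⟩
    rw [hsd, Finset.sum_insert h, hj, add_comm]

/-- **Exactly half of the sub-sums are non-zero at a point of the zero-set complement.** -/
theorem two_mul_card_subsum_ne_zero (σ : Fin m → CubeFn (ZMod 2) n) (u : Fin n → Bool)
    (hu : ∃ j, σ j u ≠ 0) :
    2 * (univ.filter fun T : Finset (Fin m) => (∑ j ∈ T, σ j) u ≠ 0).card = 2 ^ m := by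
  classical
  obtain ⟨j₀, hj₀⟩ := hu
  have hj : σ j₀ u = 1 := by
    have h01 : ∀ x : ZMod 2, x ≠ 0 → x = 1 := by decide
    exact h01 _ hj₀
  set A := univ.filter fun T : Finset (Fin m) => (∑ j ∈ T, σ j) u ≠ 0 with hA
  set B := univ.filter fun T : Finset (Fin m) => ¬ (∑ j ∈ T, σ j) u ≠ 0 with hB
  have hAB : A.card = B.card := by
    refine Finset.card_bij' (fun T _ => symmDiff T {j₀}) (fun T _ => symmDiff T {j₀}) ?_ ?_ ?_ ?_
    · intro T hT
      simp only [hA, hB, mem_filter, mem_univ, true_and, not_not] at hT ⊢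
      rw [subsum_symmDiff_apply σ u T j₀ hj]
      have h01 : ∀ x : ZMod 2, x ≠ 0 → x + 1 = 0 := by decide
      exact h01 _ hT
    · intro T hT
      simp only [hA, hB, mem_filter, mem_univ, true_and, not_not] at hT ⊢
      rw [subsum_symmDiff_apply σ u T j₀ hj, hT, zero_add]
      exact one_ne_zero
    · intro T _
      simp [symmDiff_symmDiff_cancel_right]
    · intro T _
      simp [symmDiff_symmDiff_cancel_right]
  have htot : A.card + B.card = 2 ^ m := by
    rw [hA, hB, Finset.card_filter_add_card_filter_not, card_univ, Fintype.card_finset,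
      Fintype.card_fin]
  omega

/-- **Transfer.** An inequality between two weighted counts of a low-degree SUPPORT, valid for every
polynomial of degree `≤ d`, holds for the zero-set complement of every vector-valued map with
coordinates of degree `≤ d`. -/
theorem support_ineq_transfer {d : ℕ} (a b : (Fin n → Bool) → ℝ)
    (h : ∀ g : CubeFn (ZMod 2) n, g ∈ lowDeg (ZMod 2) n d →
      ∑ u ∈ univ.filter (fun u : Fin n → Bool => g u ≠ 0), a u ≤
        ∑ u ∈ univ.filter (fun u : Fin n → Bool => g u ≠ 0), b u)
    (σ : Fin m → CubeFn (ZMod 2) n) (hσ : ∀ j, σ j ∈ lowDeg (ZMod 2) n d) :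
    ∑ u ∈ univ.filter (fun u : Fin n → Bool => ∃ j, σ j u ≠ 0), a u ≤
      ∑ u ∈ univ.filter (fun u : Fin n → Bool => ∃ j, σ j u ≠ 0), b u := by
  classical
  -- sum the hypothesis over all sub-sums
  have hsum : ∑ T : Finset (Fin m), ∑ u ∈ univ.filter (fun u : Fin n → Bool => (∑ j ∈ T, σ j) u ≠ 0), a u ≤
      ∑ T : Finset (Fin m), ∑ u ∈ univ.filter (fun u : Fin n → Bool => (∑ j ∈ T, σ j) u ≠ 0), b u :=
    Finset.sum_le_sum fun T _ => h _ (subsum_mem_lowDeg σ hσ T)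
  -- exchange the sums: every `u ∈ Z` is counted `2^{m-1}` times, every `u ∉ Z` zero times
  have hswap : ∀ w : (Fin n → Bool) → ℝ,
      ∑ T : Finset (Fin m), ∑ u ∈ univ.filter (fun u : Fin n → Bool => (∑ j ∈ T, σ j) u ≠ 0), w u =
        ∑ u ∈ univ.filter (fun u : Fin n → Bool => ∃ j, σ j u ≠ 0),
          ((univ.filter fun T : Finset (Fin m) => (∑ j ∈ T, σ j) u ≠ 0).card : ℝ) * w u := by
    intro w
    have h1 : ∀ T : Finset (Fin m), ∑ u ∈ univ.filter (fun u : Fin n → Bool => (∑ j ∈ T, σ j) u ≠ 0), w u =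
        ∑ u : Fin n → Bool, (if (∑ j ∈ T, σ j) u ≠ 0 then w u else 0) := fun T => Finset.sum_filter _ _
    have h2 : ∀ u : Fin n → Bool, ∑ T : Finset (Fin m), (if (∑ j ∈ T, σ j) u ≠ 0 then w u else 0) =
        ((univ.filter fun T : Finset (Fin m) => (∑ j ∈ T, σ j) u ≠ 0).card : ℝ) * w u := fun u => by
      rw [← Finset.sum_filter, Finset.sum_const, nsmul_eq_mul]
    rw [Finset.sum_congr rfl fun T _ => h1 T, Finset.sum_comm, Finset.sum_congr rfl fun u _ => h2 u]
    symm
    refine Finset.sum_subset (Finset.filter_subset _ _) fun u _ hu => ?_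
    have hu' : ∀ j, σ j u = 0 := fun j => by
      by_contra hne
      exact hu (Finset.mem_filter.2 ⟨Finset.mem_univ _, j, hne⟩)
    have hcard : (univ.filter fun T : Finset (Fin m) => (∑ j ∈ T, σ j) u ≠ 0) = ∅ := by
      refine Finset.filter_eq_empty_iff.2 fun T _ => ?_
      rw [not_not, Finset.sum_apply]
      exact Finset.sum_eq_zero fun j _ => hu' j
    rw [hcard, Finset.card_empty, Nat.cast_zero, zero_mul]
  rw [hswap a, hswap b] at hsum
  -- divide by `2^{m-1}`
  have hhalf : ∀ u ∈ univ.filter (fun u : Fin n → Bool => ∃ j, σ j u ≠ 0),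
      ((univ.filter fun T : Finset (Fin m) => (∑ j ∈ T, σ j) u ≠ 0).card : ℝ) = (2 : ℝ) ^ m / 2 := by
    intro u hu
    have h2 := two_mul_card_subsum_ne_zero σ u (Finset.mem_filter.1 hu).2
    have h2' : (2 : ℝ) * ((univ.filter fun T : Finset (Fin m) => (∑ j ∈ T, σ j) u ≠ 0).card : ℝ) =
        (2 : ℝ) ^ m := by exact_mod_cast h2
    linarith
  have hA : ∑ u ∈ univ.filter (fun u : Fin n → Bool => ∃ j, σ j u ≠ 0),
      ((univ.filter fun T : Finset (Fin m) => (∑ j ∈ T, σ j) u ≠ 0).card : ℝ) * a u =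
      ∑ u ∈ univ.filter (fun u : Fin n → Bool => ∃ j, σ j u ≠ 0), (2 : ℝ) ^ m / 2 * a u :=
    Finset.sum_congr rfl fun u hu => by rw [hhalf u hu]
  have hB : ∑ u ∈ univ.filter (fun u : Fin n → Bool => ∃ j, σ j u ≠ 0),
      ((univ.filter fun T : Finset (Fin m) => (∑ j ∈ T, σ j) u ≠ 0).card : ℝ) * b u =
      ∑ u ∈ univ.filter (fun u : Fin n → Bool => ∃ j, σ j u ≠ 0), (2 : ℝ) ^ m / 2 * b u :=
    Finset.sum_congr rfl fun u hu => by rw [hhalf u hu]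
  rw [hA, hB, ← Finset.mul_sum, ← Finset.mul_sum] at hsum
  have hpos : (0 : ℝ) < (2 : ℝ) ^ m / 2 := by positivity
  exact le_of_mul_le_mul_left hsum hpos

/-- **PLDAMS for vector-valued maps.** With the constants of `pldams_allDensities`: for all large `n`,
`d ≤ c√n` and every `σ : {0,1}ⁿ → 𝔽₂^m` with coordinates of degree `≤ d`, each residue class
`|u| ≡ r (mod 3)` holds a `κ`-fraction of `{u : σ u ≠ 0}`. -/
theorem pldams_vector :
    ∃ κ : ℝ, 0 < κ ∧ ∃ c : ℝ, 0 < c ∧ ∃ n₀ : ℕ, ∀ n : ℕ, n₀ ≤ n → ∀ r d m : ℕ,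
      (d : ℝ) ≤ c * Real.sqrt n → ∀ σ : Fin m → CubeFn (ZMod 2) n,
        (∀ j, σ j ∈ lowDeg (ZMod 2) n d) →
          κ * ((univ.filter fun u : Fin n → Bool => ∃ j, σ j u ≠ 0).card : ℝ) ≤
            ((univ.filter fun u : Fin n → Bool => (∃ j, σ j u ≠ 0) ∧ wt u % 3 = r % 3).card : ℝ) := by
  classical
  obtain ⟨κ, hκ, c, hc, n₀, hP⟩ := pldams_allDensities
  refine ⟨κ, hκ, c, hc, n₀, fun n hn r d m hd σ hσ => ?_⟩
  have key := support_ineq_transfer (d := d) (fun _ => κ)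
    (fun u => if wt u % 3 = r % 3 then (1 : ℝ) else 0) (fun g hg => ?_) σ hσ
  · rw [Finset.sum_const, nsmul_eq_mul, mul_comm, ← Finset.sum_filter, Finset.filter_filter,
      Finset.sum_const, nsmul_eq_mul, mul_one] at key
    exact key
  · have h := hP n hn r d hd g hg
    rw [Finset.sum_const, nsmul_eq_mul, mul_comm, ← Finset.sum_filter, Finset.filter_filter,
      Finset.sum_const, nsmul_eq_mul, mul_one]
    exact h

end Summit.QuantumAdvantage.AdviceFreeQNC0
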